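/-
Copyright (c) 2026. All rights reserved.
Released under Apache 2.0 license as described in the file LICENSE.
Authors: abc-iut cell, fact-proving seat abc-iut-f-102 (block F, tranche 102, gen 2).
-/
import Literature.AnabelianGeometry.AbsoluteAnabelian.LogFrobeniusShiftActionPostLogPair
import HarnessLib

/-!
# [AbsTopIII] Corollary 5.5 (v): PINNING — a realising family is shift-invariant on every pair of paths into a core vertex

S. Mochizuki, *Topics in absolute anabelian geometry III: global reconstruction algorithms*,
J. Math. Sci. Univ. Tokyo 22 (2015) 939–1156 [MochizukiAbsTopIII2015]; locators `p.N` = pages of the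
author's manuscript (`paper:url-5493eb38cbb7`): §0 p. 26, Def 3.5 (ii), (iii) pp. 75–76, Cor 5.5 (i) p. 130, (iii)
p. 131, (v) pp. 131–132 (proof p. 133: "immediate from the definitions").

PROOF-ONLY companion of `LogFrobeniusShiftInvariantPart.lean` / `LogFrobeniusShiftActionPostLogPair.lean` (this seat),
step 2 of THEOREM A (F-0157 ⟺ `∃ K`, F-0159).  For EVERY setting `L`, every family `K` on `D•⊢`, every vertex `x` outside
the first two rows and one place `v₀` at which `K` carries the observable `S_log⊞_{v₀}` of Cor 5.5 (iii):
* `DVertex.shift_fixed_of_path`, `shiftInvariantE_of_source_fixed`: boundary pairs out of `□` (or any shift-fixed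
  vertex) are shift-fixed, hence shift-invariant;
* `shiftInvariantE_symm`: if both orders of a pair (and their shifts) are boundary pairs, the homotopies are mutually
  inverse (Def 3.5 (ii)), so invariance of one order gives invariance of the other;
* **`shiftInvariantE_of_row1` (PINNING)**: if ALL co-verticial pairs `𝒳_⋎ → x` and `□ → x` are boundary pairs of `K`
  (as for a CORE with core vertex `x` embedded in `K`, Def 3.5 (iii)), every pair `𝒳_⋎ → x` is shift-invariant —
  induction on the total length: equal heads (`log`/`log`, `id`/`id`) reduce by the pre-composition axiom of Def 3.5
  (ii), mixed heads factor (second axiom) through the post-log pair whiskered by a shortest tail `𝒩⊞_{v₀} → x` and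
  through its inverse.  Inside ONE family the cores leave one free homotopy per `𝒳_⋎` and `S_log⊞` pins it — print's
  "immediate from the definitions" (p. 133) at the typed interface.
Refereed pre-IUT material; nothing here bears on [IUTchIII] Cor. 3.12; typed ≠ proved.
-/

set_option autoImplicit false

universe v u w

open CategoryTheory Quiver

namespace Literature.AnabelianGeometry.AbsoluteAnabelian

/-! ## Bookkeeping -/

/-- Inverses of heterogeneously equal isomorphisms agree (Def 3.5 (ii) bookkeeping: a symmetric pair of boundary pairs
has mutually inverse homotopies). [cite: MochizukiAbsTopIII2015, Definition 3.5 (ii) p.75] -/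
theorem CategoryTheory.inv_heq_of_heq {C C' : Type u} [i : Category.{v} C] [i' : Category.{v} C'] (hC : C = C')
    (hi : HEq i i') {X Y : C} {X' Y' : C'} (hX : HEq X X') (hY : HEq Y Y') {f : X ⟶ Y} {f' : X' ⟶ Y'}
    [IsIso f] [IsIso f'] (hf : HEq f f') : HEq (inv f) (inv f') := by
  subst hC; cases hi; cases hX; cases hY; cases hf; rfl

/-- Heterogeneously equal paths extend by heterogeneously equal arrows. [cite: MochizukiAbsTopIII2015, Section 0 p.26] -/
theorem Quiver.Path.cons_heq {V : Type w} [Quiver.{v} V] {a a' b b' c c' : V} (ha : a = a') (hb : b = b') (hc : c = c')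
    {p : Path a b} {p' : Path a' b'} (hp : HEq p p') {e : b ⟶ c} {e' : b' ⟶ c'} (he : HEq e e') :
    HEq (p.cons e) (p'.cons e') := by
  subst ha hb hc; cases hp; cases he; rfl

/-! ## The oriented graph `Γ⃗_{D•⊢}` near its first two rows -/

namespace DVertex

variable {Vmod : Type u} {isArc : Vmod → Bool}

/-- The arrows out of `𝒳_⋎` are `id_⋎` and `log`. [cite: MochizukiAbsTopIII2015, Cor 5.5 p. 129] -/
theorem hom_row1_cases {m : ℤ} {c : DVertex Vmod isArc} (e : (row1 m : DVertex Vmod isArc) ⟶ c) :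
    (∃ _ : c = core, HEq e (DEdge.toCore (isArc := isArc) m)) ∨
      ∃ (n : ℤ) (_ : m = n + 1) (_ : c = row1 n), HEq e (DEdge.log (isArc := isArc) n) := by
  cases e with
  | log n => exact Or.inr ⟨n, rfl, rfl, HEq.rfl⟩
  | toCore n => exact Or.inl ⟨rfl, HEq.rfl⟩

/-- The arrows out of `□` are the `λ⊞_{v,ν}`, `ν` pre-log. [cite: MochizukiAbsTopIII2015, Cor 5.5 p. 129] -/
theorem hom_core_cases {c : DVertex Vmod isArc} (e : (core : DVertex Vmod isArc) ⟶ c) :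
    ∃ (v : Vmod) (ν : LogVertex (isArc v)) (hν : ν.isPostLog = false) (_ : c = nplus v),
      HEq e (DEdge.lam (isArc := isArc) v ν hν) := by
  cases e with
  | lam v ν hν => exact ⟨v, ν, hν, rfl, HEq.rfl⟩

/-- A vertex fixed by every shift is not in the first row. [cite: MochizukiAbsTopIII2015, Cor 5.5 (v) p. 132] -/
theorem ne_row1_of_shift_eq {x : DVertex Vmod isArc} (hx : ∀ k : ℤ, x.shift k = x) (m : ℤ) : x ≠ row1 m := by
  rintro rfl
  have h := hx 1
  simp only [DVertex.shift, row1.injEq] at h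
  omega

/-- **Paths out of a shift-fixed vertex are shift-fixed** (they never enter the first row): the end-vertex is fixed and
the shifted path is the path (heterogeneously). [cite: MochizukiAbsTopIII2015, Cor 5.5 (v) p. 132] -/
theorem shift_fixed_of_path {a : DVertex Vmod isArc} (ha : ∀ k : ℤ, a.shift k = a) :
    ∀ {b : DVertex Vmod isArc} (P : Path a b), (∀ k : ℤ, b.shift k = b) ∧
      ∀ k : ℤ, HEq ((shiftGraph (isArc := isArc) k).mapPath P) P
  | _, .nil => ⟨ha, fun k => by
      rw [Prefunctor.mapPath_nil]
      exact (heq_of_eq_of_heq rfl (by rw [show (shiftGraph k).obj a = a from ha k] : HEq (Path.nil :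
        Path ((shiftGraph (isArc := isArc) k).obj a) ((shiftGraph k).obj a)) (Path.nil : Path a a)))⟩
  | _, .cons P e => by
    obtain ⟨hb, hP⟩ := shift_fixed_of_path ha P
    cases e with
    | log n => exact absurd (hb 1) (by simp only [DVertex.shift, row1.injEq]; omega)
    | toCore n => exact absurd (hb 1) (by simp only [DVertex.shift, row1.injEq]; omega)
    | _ =>
      refine ⟨fun k => rfl, fun k => ?_⟩
      rw [Prefunctor.mapPath_cons]
      exact Quiver.Path.cons_heq (ha k) (hb k) rfl (hP k) HEq.rfl

end DVertex

namespace LogFrobeniusSetting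

open DiagramOfCategories

variable {Vmod : Type u} {isArc : Vmod → Bool} {L : LogFrobeniusSetting Vmod isArc}

/-! ## Shift-fixed pairs are shift-invariant -/

/-- **A boundary pair of shift-fixed paths is a shift-invariant pair** (its shifts are the pair itself).
[cite: MochizukiAbsTopIII2015, Definition 3.5 (v) p.76] -/
theorem shiftInvariantE_of_fixed (K : L.diagram.HomotopyFamily) {a b : DVertex Vmod isArc} (ha : ∀ k : ℤ, a.shift k = a)
    (hb : ∀ k : ℤ, b.shift k = b) {P Q : Path a b} (hP : ∀ k : ℤ, HEq ((DVertex.shiftGraph k).mapPath P) P)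
    (hQ : ∀ k : ℤ, HEq ((DVertex.shiftGraph k).mapPath Q) Q) (h : K.E P Q) : L.ShiftInvariantE K P Q := by
  refine ⟨h, fun k => ⟨(K.E_iff_of_heq (ha k) (hb k) (hP k) (hQ k)).mpr h, fun h₀ y y' hy => ?_⟩⟩
  exact K.η_app_heq_of_heq (ha k) (hb k) (hP k) (hQ k) _ h₀ hy

/-- Pairs of paths out of `□` (or any shift-fixed vertex) are shift-invariant as soon as they are boundary pairs.
[cite: MochizukiAbsTopIII2015, Definition 3.5 (v) p.76] -/
theorem shiftInvariantE_of_source_fixed (K : L.diagram.HomotopyFamily) {a b : DVertex Vmod isArc}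
    (ha : ∀ k : ℤ, a.shift k = a) {P Q : Path a b} (h : K.E P Q) : L.ShiftInvariantE K P Q :=
  shiftInvariantE_of_fixed K ha (DVertex.shift_fixed_of_path ha P).1 (DVertex.shift_fixed_of_path ha P).2
    (DVertex.shift_fixed_of_path ha Q).2 h

/-! ## Symmetric boundary pairs: inverse homotopies -/

/-- If both `(γ₁,γ₂)` and `(γ₂,γ₁)` are boundary pairs, their homotopies are mutually inverse (Def 3.5 (ii): composite =
homotopy of `(γ₁,γ₁)` = identity). [cite: MochizukiAbsTopIII2015, Definition 3.5 (ii) p.75] -/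
theorem η_comp_η_eq_id (K : L.diagram.HomotopyFamily) {a b : DVertex Vmod isArc} {P Q : Path a b} (h : K.E P Q)
    (h' : K.E Q P) : K.η h ≫ K.η h' = 𝟙 _ := by
  rw [← K.η_trans h h', K.η_refl]

/-- … so each is an isomorphism. [cite: MochizukiAbsTopIII2015, Definition 3.5 (ii) p.75] -/
theorem isIso_η_app_of_symm (K : L.diagram.HomotopyFamily) {a b : DVertex Vmod isArc} {P Q : Path a b} (h : K.E P Q)
    (h' : K.E Q P) (y : L.diagram.obj a) : IsIso ((K.η h).app y) :=
  ⟨⟨(K.η h').app y, by rw [← NatTrans.comp_app, η_comp_η_eq_id K h h']; rfl,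
    by rw [← NatTrans.comp_app, η_comp_η_eq_id K h' h]; rfl⟩⟩

/-- … with inverse the homotopy of the swapped pair. [cite: MochizukiAbsTopIII2015, Definition 3.5 (ii) p.75] -/
theorem η_app_eq_inv_of_symm (K : L.diagram.HomotopyFamily) {a b : DVertex Vmod isArc} {P Q : Path a b} (h : K.E P Q)
    (h' : K.E Q P) (y : L.diagram.obj a) :
    (K.η h').app y = @inv _ _ _ _ ((K.η h).app y) (isIso_η_app_of_symm K h h' y) := by
  haveI := isIso_η_app_of_symm K h h' y
  refine (IsIso.inv_eq_of_hom_inv_id ?_).symm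
  rw [← NatTrans.comp_app, η_comp_η_eq_id K h h']; rfl

/-- **The swap of a shift-invariant pair is shift-invariant** as soon as it (and its shifts) are boundary pairs: the
homotopies of the swapped pairs are the inverses (Def 3.5 (ii)), and inverses of invariant isomorphisms are invariant.
[cite: MochizukiAbsTopIII2015, Definition 3.5 (v) p.76] -/
theorem shiftInvariantE_symm (K : L.diagram.HomotopyFamily) {a b : DVertex Vmod isArc} {P Q : Path a b}
    (hPQ : L.ShiftInvariantE K P Q) (hQP : K.E Q P)
    (hQP' : ∀ k : ℤ, K.E ((DVertex.shiftGraph k).mapPath Q) ((DVertex.shiftGraph k).mapPath P)) :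
    L.ShiftInvariantE K Q P := by
  refine ⟨hQP, fun k => ⟨hQP' k, fun h₀ y y' hy => ?_⟩⟩
  obtain ⟨h', e⟩ := hPQ.2 k
  rw [η_app_eq_inv_of_symm K h' (hQP' k) y', η_app_eq_inv_of_symm K hPQ.1 h₀ y]
  exact @CategoryTheory.inv_heq_of_heq _ _ _ _ (L.obj_shift_eq k b) (L.cat_shift_heq k b) _ _ _ _
    (L.pathFunctor_shift_obj_heq k P hy) (L.pathFunctor_shift_obj_heq k Q hy) _ _
    (isIso_η_app_of_symm K h' (hQP' k) y') (isIso_η_app_of_symm K hPQ.1 h₀ y) (e hPQ.1 y y' hy)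

/-! ## PINNING: every pair `𝒳_⋎ → x` is shift-invariant -/

section Pinning

variable {K : L.diagram.HomotopyFamily} {x : DVertex Vmod isArc} (hx : ∀ k : ℤ, x.shift k = x)
  (hrow : ∀ (m : ℤ) (P Q : Path (DVertex.row1 m : DVertex Vmod isArc) x), K.E P Q)
  (hcore : ∀ P Q : Path (DVertex.core : DVertex Vmod isArc) x, K.E P Q)

include hx hrow in
/-- If all pairs `𝒳_⋎ → x` are boundary pairs, so are their shifts. [cite: MochizukiAbsTopIII2015, Definition 3.5 (iii) p.75] -/
theorem E_shift_of_forall_row1 (k m : ℤ) (P Q : Path (DVertex.row1 m : DVertex Vmod isArc) x) :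
    K.E ((DVertex.shiftGraph k).mapPath P) ((DVertex.shiftGraph k).mapPath Q) := by
  have hb : (DVertex.shiftGraph k).obj x = x := hx k
  have hT : Path ((DVertex.shiftGraph k).obj (DVertex.row1 m : DVertex Vmod isArc)) ((DVertex.shiftGraph k).obj x) =
      Path (DVertex.row1 (m + k) : DVertex Vmod isArc) x := by rw [hb]; rfl
  exact (K.E_iff_of_heq (rfl : (DVertex.shiftGraph k).obj (DVertex.row1 m : DVertex Vmod isArc) = DVertex.row1 (m + k))
    hb (cast_heq hT _).symm (cast_heq hT _).symm).mpr (hrow (m + k) _ _)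

include hcore in
/-- `□`-level pairs into `x` are shift-invariant pairs of `K`. [cite: MochizukiAbsTopIII2015, Cor 5.5 (v) p. 133] -/
theorem shiftInvariantE_of_core (P Q : Path (DVertex.core : DVertex Vmod isArc) x) : L.ShiftInvariantE K P Q :=
  shiftInvariantE_of_source_fixed K (fun _ => rfl) (hcore P Q)

/-- Lengths: `[λ⊞]∘…` preceded by `id_⋎` and a tail. [folklore] -/
private theorem length_toCore_lam_comp {m : ℤ} {v : Vmod} (ν : LogVertex (isArc v)) (hν : ν.isPostLog = false)
    (t : Path (DVertex.nplus v : DVertex Vmod isArc) x) :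
    ((Path.nil.cons (DEdge.toCore m : (DVertex.row1 m : DVertex Vmod isArc) ⟶ .core)).comp
      ((Path.nil.cons (DEdge.lam v ν hν : (DVertex.core : DVertex Vmod isArc) ⟶ .nplus v)).comp t)).length =
      t.length + 2 := by
  simp only [Path.length_comp, Path.length_cons, Path.length_nil]; omega

/-- Lengths: a path `□ → x` is a `λ⊞` followed by a path `𝒩⊞_v → x`. [cite: MochizukiAbsTopIII2015, Cor 5.5 p. 129] -/
theorem length_core_path_ge (hxc : x ≠ .core) {v₀ : Vmod} (t : Path (DVertex.nplus v₀ : DVertex Vmod isArc) x)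
    (ht : ∀ (v : Vmod) (q : Path (DVertex.nplus v : DVertex Vmod isArc) x), t.length ≤ q.length)
    (Q : Path (DVertex.core : DVertex Vmod isArc) x) : t.length + 1 ≤ Q.length := by
  have hQ : Q.length ≠ 0 := fun h0 => hxc (Path.eq_of_length_zero Q h0).symm
  obtain ⟨c, e, q, rfl, hlen⟩ := (Path.length_ne_zero_iff_eq_comp Q).mp hQ
  obtain ⟨v, ν, hν, rfl, -⟩ := DVertex.hom_core_cases e
  rw [hlen]
  exact Nat.add_le_add_right (ht v q) 1

include hx hrow hcore in
/-- **PINNING.**  Let `x` be a vertex of `D•⊢` outside the first two rows, `K` a family of homotopies on `D•⊢` in which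
ALL co-verticial pairs of paths `𝒳_⋎ → x` and `□ → x` are boundary pairs (as for the family of a CORE with core vertex
`x`, Def 3.5 (iii), embedded in `K`), and suppose `K` carries the observable `S_log⊞_{v₀}` of Cor 5.5 (iii) at one place
`v₀` from which `x` is reached by a shortest tail `t`.  Then EVERY pair of paths `𝒳_⋎ → x` is a shift-invariant pair of
`K`: the homotopies of `K` on these pairs are determined by the `□`-level ones and the post-log homotopies `ι⊞_{v₀,ε}`
(induction on the total length; `log`/`id_⋎` head cases by the pre-composition axiom, mixed heads through the post-log
pair and its inverse). [cite: MochizukiAbsTopIII2015, Cor 5.5 (v) p. 133] -/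
theorem shiftInvariantE_of_row1 (hxc : x ≠ .core) {v₀ : Vmod} (t : Path (DVertex.nplus v₀ : DVertex Vmod isArc) x)
    (ht : ∀ (v : Vmod) (q : Path (DVertex.nplus v : DVertex Vmod isArc) x), t.length ≤ q.length)
    (hobs : ∃ H : (L.logDiagramPlus v₀).HomotopyFamily, L.IsLogObservablePlus v₀ H ∧ L.CompatibleIn K H)
    (m : ℤ) (P Q : Path (DVertex.row1 m : DVertex Vmod isArc) x) : L.ShiftInvariantE K P Q := by
  obtain ⟨ν₂, ε, h₂⟩ := LogVertex.exists_postLog_edge (isArc v₀)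
  have hS := shiftInvariantE_isSaturated (L := L) K
  -- notation: the post-log pair at `⋎ = n`, whiskered by the tail `t`
  let lamE : (ν : LogVertex (isArc v₀)) → ν.isPostLog = false → ((DVertex.core : DVertex Vmod isArc) ⟶ .nplus v₀) :=
    fun ν hν => DEdge.lam v₀ ν hν
  let B' : (ν : LogVertex (isArc v₀)) → ν.isPostLog = false → Path (DVertex.core : DVertex Vmod isArc) x :=
    fun ν hν => (Path.nil.cons (lamE ν hν)).comp t
  let A' : (n : ℤ) → Path (DVertex.row1 n : DVertex Vmod isArc) x := fun n =>
    (Path.nil.cons (DEdge.toCore n : (DVertex.row1 n : DVertex Vmod isArc) ⟶ .core)).comp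
      (B' (LogVertex.spaceLink _) (spaceLink_isPostLog _))
  -- the cross pair `([t]∘[λ_sl]∘[id_n]∘[log], [t]∘[λ_ν₂]∘[id_{n+1}])` is shift-invariant (post-composition axiom)
  have hcross : ∀ n : ℤ, L.ShiftInvariantE K
      ((Path.nil.cons (DEdge.log n : (DVertex.row1 (n + 1) : DVertex Vmod isArc) ⟶ .row1 n)).comp (A' n))
      ((Path.nil.cons (DEdge.toCore (n + 1) : (DVertex.row1 (n + 1) : DVertex Vmod isArc) ⟶ .core)).comp (B' ν₂ h₂)) := by
    intro n
    have h := hS.postcomp (L.shiftInvariantE_postLogPair v₀ hobs ε h₂ n) t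
    simp only [Path.comp_assoc] at h
    exact h
  -- lengths
  have hA' : ∀ n : ℤ, (A' n).length = t.length + 2 := fun n => length_toCore_lam_comp _ _ t
  have hne : ∀ (m : ℤ) (P : Path (DVertex.row1 m : DVertex Vmod isArc) x), P.length ≠ 0 := fun m P h0 =>
    DVertex.ne_row1_of_shift_eq hx m (Path.eq_of_length_zero P h0).symm
  -- induction on the total length
  suffices main : ∀ (N : ℕ) (m : ℤ) (P Q : Path (DVertex.row1 m : DVertex Vmod isArc) x),
      P.length + Q.length ≤ N → L.ShiftInvariantE K P Q from main _ m P Q le_rfl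
  intro N
  induction N with
  | zero =>
    intro m P Q hN
    exact absurd (Nat.eq_zero_of_le_zero (le_trans (Nat.le_add_right _ _) hN)) (hne m P)
  | succ N ih =>
    intro m P Q hN
    obtain ⟨c, e, P', rfl, hP⟩ := (Path.length_ne_zero_iff_eq_comp P).mp (hne m P)
    obtain ⟨c', e', Q', rfl, hQ⟩ := (Path.length_ne_zero_iff_eq_comp Q).mp (hne m Q)
    rw [hP, hQ] at hN
    -- a `log`-first / `id`-first pair factors through the cross pair (for every such pair at this level)
    have mixed : ∀ (n : ℤ) (P' : Path (DVertex.row1 n : DVertex Vmod isArc) x)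
        (Q' : Path (DVertex.core : DVertex Vmod isArc) x), P'.length + 1 + (Q'.length + 1) ≤ N + 1 →
        L.ShiftInvariantE K
          ((Path.nil.cons (DEdge.log n : (DVertex.row1 (n + 1) : DVertex Vmod isArc) ⟶ .row1 n)).comp P')
          ((Path.nil.cons (DEdge.toCore (n + 1) : (DVertex.row1 (n + 1) : DVertex Vmod isArc) ⟶ .core)).comp Q') := by
      intro n P' Q' hN'
      have hQ' := length_core_path_ge hxc t ht Q'
      refine hS.trans (hS.trans (hS.precomp (ih n P' (A' n) (by rw [hA']; omega)) _) (hcross n)) ?_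
      exact hS.precomp (shiftInvariantE_of_core hcore _ _) _
    rcases DVertex.hom_row1_cases e with ⟨rfl, he⟩ | ⟨n, rfl, rfl, he⟩ <;>
      rcases DVertex.hom_row1_cases e' with ⟨rfl, he'⟩ | ⟨n', hn', rfl, he'⟩
    · -- both through `id_⋎`: a `□`-level pair, pre-composed
      obtain rfl : e = e' := (eq_of_heq he).trans (eq_of_heq he').symm
      exact hS.precomp (shiftInvariantE_of_core hcore P' Q') _
    · -- `P` through `id_m`, `Q` through `log`: the inverse of a mixed pair
      obtain rfl : m = n' + 1 := hn'
      obtain rfl : e = DEdge.toCore (n' + 1) := eq_of_heq he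
      obtain rfl : e' = DEdge.log n' := eq_of_heq he'
      exact shiftInvariantE_symm K (mixed n' Q' P' (by omega)) (hrow _ _ _)
        (fun k => E_shift_of_forall_row1 hx hrow k _ _ _)
    · -- `P` through `log`, `Q` through `id`: a mixed pair
      obtain rfl : e = DEdge.log n := eq_of_heq he
      obtain rfl : e' = DEdge.toCore (n + 1) := eq_of_heq he'
      exact mixed n P' Q' hN
    · -- both through `log`: a shorter pair at `⋎ = n`, pre-composed
      obtain rfl : n' = n := by omega
      obtain rfl : e = e' := (eq_of_heq he).trans (eq_of_heq he').symm
      exact hS.precomp (ih _ P' Q' (by omega)) _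

end Pinning

end LogFrobeniusSetting

end Literature.AnabelianGeometry.AbsoluteAnabelian
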